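import Literature.Probability.Percolation.DislocationLoopCover
import Literature.Probability.LatticeModels.ThermodynamicLimit
import Mathlib.Topology.Algebra.InfiniteSum.ENNReal
import HarnessLib

/-!
# `PercLoopDislocationCovers.CoverSubcritTransfer` (stmt-CriticalPhenomena-13952) — IV: patch geometry

RSW3 lane (lead, gen 31).  Helper lemmas for item `stmt-CriticalPhenomena-13952` (route `PercLoopDislocationCovers`): the
elementary geometry of the dislocation patches of `G_s = dislocationLoopCover s` behind the counting hypotheses of
`…CoverSubcritTransferSums`.  A site `u ∈ ℤ³` *lies over the label* `P` if `u` or `u − e₁` is a patch base labelled `P`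
(the endpoints of the patch bonds, `IsPatchBase` / `patchLabel` of the Literature API); with `t = ⌊s/2⌋`:

* `offsets_of_over` — such a `u` is `patchCorner s P + (i, δ, j)` with `0 ≤ i, j < t`, `δ ∈ {0, 1}`;
* `tsum_indicator_over_le` — at most `2t²` sites lie over a label; `label_unique` — a site lies over at most one label (`s ≥ 2`);
* `abs_sub_ge_of_over` — sites over DISTINCT labels `P ≠ P′` are separated coordinatewise: `t |P′_j − P_j| ≤ |u_j − z_j|`.

No definitions, no sorries.  References: N. Biggs, *Algebraic Graph Theory*, Def. 19.1 [Biggs1974] (the cover);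
G. Grimmett, *Percolation* (1999), §2.3 [GrimmettPercolation1999].
-/

noncomputable section

namespace Summit.CriticalPhenomena.PercolationContinuityZ3.Theorems

namespace CoverSubcritTransfer

open Literature.Probability.LatticeModels Literature.Probability.Percolation
open Literature.Probability.Percolation.DislocationLoopCover
open scoped ENNReal

/-! ### Offsets from the patch corner -/

/-- **A patch base is its corner plus a small offset**: if `u` is a patch base labelled `P` then
`u = patchCorner s P + (i, 0, j)` with `0 ≤ i, j < ⌊s/2⌋`. [cite: Biggs1974, Def. 19.1] -/
theorem offsets_of_isPatchBase {s : ℕ} (hs : 2 ≤ s) {u : Site 3} {P : ℤ × ℤ × ℤ} (hu : IsPatchBase s u)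
    (hP : patchLabel s u = P) :
    (0 ≤ u 0 - patchCorner s P 0 ∧ u 0 - patchCorner s P 0 < (s / 2 : ℕ)) ∧ u 1 - patchCorner s P 1 = 0 ∧
      (0 ≤ u 2 - patchCorner s P 2 ∧ u 2 - patchCorner s P 2 < (s / 2 : ℕ)) := by
  have hs0 : (s : ℤ) ≠ 0 := by exact_mod_cast (show s ≠ 0 by omega)
  obtain ⟨h1, h0, h2⟩ := hu
  simp only [patchLabel, Prod.ext_iff] at hP
  obtain ⟨hP0, hP1, hP2⟩ := hP
  rw [patchCorner_apply_zero, patchCorner_apply_one, patchCorner_apply_two, ← hP0, ← hP1, ← hP2]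
  have e0 := Int.emod_add_mul_ediv (u 0 - (s / 2 : ℕ)) s
  have e1 := Int.mul_ediv_cancel' h1
  have e2 := Int.emod_add_mul_ediv (u 2) s
  have m0 := Int.emod_nonneg (u 0 - (s / 2 : ℕ)) hs0
  have m2 := Int.emod_nonneg (u 2) hs0
  refine ⟨⟨by linarith, by linarith⟩, by linarith, by linarith, by linarith⟩

/-- **A site over the label `P` is the corner plus `(i, δ, j)`**, `0 ≤ i, j < ⌊s/2⌋`, `δ ∈ {0, 1}`. [cite: Biggs1974, Def. 19.1] -/
theorem offsets_of_over {s : ℕ} (hs : 2 ≤ s) {u : Site 3} {P : ℤ × ℤ × ℤ}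
    (hu : (IsPatchBase s u ∧ patchLabel s u = P) ∨
      (IsPatchBase s (u - Pi.single 1 1) ∧ patchLabel s (u - Pi.single 1 1) = P)) :
    (0 ≤ u 0 - patchCorner s P 0 ∧ u 0 - patchCorner s P 0 < (s / 2 : ℕ)) ∧
      (u 1 - patchCorner s P 1 = 0 ∨ u 1 - patchCorner s P 1 = 1) ∧
      (0 ≤ u 2 - patchCorner s P 2 ∧ u 2 - patchCorner s P 2 < (s / 2 : ℕ)) := by
  rcases hu with ⟨hb, hP⟩ | ⟨hb, hP⟩
  · obtain ⟨h0, h1, h2⟩ := offsets_of_isPatchBase hs hb hP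
    exact ⟨h0, Or.inl h1, h2⟩
  · obtain ⟨h0, h1, h2⟩ := offsets_of_isPatchBase hs hb hP
    simp only [Pi.sub_apply, Pi.single_apply] at h0 h1 h2
    simp only [show ((0 : Fin 3) = 1) = False by decide, show ((2 : Fin 3) = 1) = False by decide,
      if_false, if_true, sub_zero] at h0 h1 h2
    exact ⟨h0, Or.inr (by linarith), h2⟩

/-! ### Counting: at most `2t²` sites over a label, one label per site -/

/-- **At most `2⌊s/2⌋²` sites lie over a label.** [folklore] -/
theorem tsum_indicator_over_le {s : ℕ} (hs : 2 ≤ s) (P : ℤ × ℤ × ℤ) :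
    ∑' u : Site 3, {u : Site 3 | (IsPatchBase s u ∧ patchLabel s u = P) ∨
        (IsPatchBase s (u - Pi.single 1 1) ∧ patchLabel s (u - Pi.single 1 1) = P)}.indicator
      (fun _ => (1 : ℝ≥0∞)) u ≤ 2 * ((s / 2 : ℕ) : ℝ≥0∞) ^ 2 := by
  classical
  set F : Finset (Site 3) := ((Finset.range (s / 2) ×ˢ Finset.range (s / 2)) ×ˢ Finset.range 2).image
    (fun q : (ℕ × ℕ) × ℕ => fun j : Fin 3 =>
      patchCorner s P j + (if j = 0 then (q.1.1 : ℤ) else if j = 1 then (q.2 : ℤ) else (q.1.2 : ℤ))) with hF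
  have hsub : {u : Site 3 | (IsPatchBase s u ∧ patchLabel s u = P) ∨
      (IsPatchBase s (u - Pi.single 1 1) ∧ patchLabel s (u - Pi.single 1 1) = P)} ⊆ ↑F := by
    intro u hu
    obtain ⟨⟨h0, h0'⟩, h1, h2, h2'⟩ := offsets_of_over hs hu
    rw [Finset.mem_coe, hF, Finset.mem_image]
    refine ⟨(((u 0 - patchCorner s P 0).toNat, (u 2 - patchCorner s P 2).toNat), (u 1 - patchCorner s P 1).toNat),
      ?_, ?_⟩
    · simp only [Finset.mem_product, Finset.mem_range]
      refine ⟨⟨?_, ?_⟩, ?_⟩ <;> omega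
    · funext j
      fin_cases j
      · simp only [Fin.zero_eta, if_true]; omega
      · simp only [Fin.mk_one, show ((1 : Fin 3) = 0) = False by decide, if_false, if_true]; omega
      · simp only [Fin.reduceFinMk, show ((2 : Fin 3) = 0) = False by decide,
          show ((2 : Fin 3) = 1) = False by decide, if_false]; omega
  have hcard : F.card ≤ 2 * (s / 2) ^ 2 := by
    refine Finset.card_image_le.trans ?_
    rw [Finset.card_product, Finset.card_product, Finset.card_range, Finset.card_range]
    nlinarith
  calc ∑' u : Site 3, {u : Site 3 | (IsPatchBase s u ∧ patchLabel s u = P) ∨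
          (IsPatchBase s (u - Pi.single 1 1) ∧ patchLabel s (u - Pi.single 1 1) = P)}.indicator
        (fun _ => (1 : ℝ≥0∞)) u
      ≤ ∑' u : Site 3, (↑F : Set (Site 3)).indicator (fun _ => (1 : ℝ≥0∞)) u :=
        ENNReal.tsum_le_tsum fun u => Set.indicator_le_indicator_of_subset hsub (fun _ => bot_le) u
    _ = ∑ u ∈ F, (↑F : Set (Site 3)).indicator (fun _ => (1 : ℝ≥0∞)) u :=
        tsum_eq_sum fun u hu => Set.indicator_of_notMem (fun h => hu (Finset.mem_coe.1 h)) _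
    _ ≤ ∑ u ∈ F, (1 : ℝ≥0∞) := Finset.sum_le_sum fun u _ => Set.indicator_le_self' (fun _ _ => bot_le) u
    _ = F.card := by simp
    _ ≤ 2 * ((s / 2 : ℕ) : ℝ≥0∞) ^ 2 := by exact_mod_cast hcard

/-- **A site lies over at most one label** (`s ≥ 2`: a site cannot be a patch base and sit above another one). [folklore] -/
theorem label_unique {s : ℕ} (hs : 2 ≤ s) (u : Site 3) (P P' : ℤ × ℤ × ℤ)
    (hP : (IsPatchBase s u ∧ patchLabel s u = P) ∨
      (IsPatchBase s (u - Pi.single 1 1) ∧ patchLabel s (u - Pi.single 1 1) = P))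
    (hP' : (IsPatchBase s u ∧ patchLabel s u = P') ∨
      (IsPatchBase s (u - Pi.single 1 1) ∧ patchLabel s (u - Pi.single 1 1) = P')) : P = P' := by
  have key : ¬ (IsPatchBase s u ∧ IsPatchBase s (u - Pi.single 1 1)) := by
    rintro ⟨⟨⟨a, ha⟩, -, -⟩, ⟨⟨b, hb⟩, -, -⟩⟩
    simp only [Pi.sub_apply, Pi.single_eq_same] at hb
    have h4 : (s : ℤ) ∣ 1 := ⟨a - b, by linarith [mul_sub (s : ℤ) a b]⟩
    have h5 := Int.le_of_dvd one_pos h4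
    omega
  rcases hP with ⟨hb, rfl⟩ | ⟨hb, rfl⟩ <;> rcases hP' with ⟨hb', rfl⟩ | ⟨hb', rfl⟩
  · rfl
  · exact absurd ⟨hb, hb'⟩ key
  · exact absurd ⟨hb', hb⟩ key
  · rfl

/-! ### Separation of distinct patches -/

/-- Elementary: offsets of size `≤ t` perturb a lattice spacing `s ≥ 2t`: `t |Δ| ≤ |s Δ + δ|` for `|δ| ≤ t`. [folklore] -/
theorem mul_abs_le_abs_add {s t Δ δ : ℤ} (hst : 2 * t ≤ s) (ht : 0 ≤ t) (hδ : |δ| ≤ t) : t * |Δ| ≤ |s * Δ + δ| := by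
  rcases eq_or_ne Δ 0 with rfl | hΔ
  · simp
  · have h1 : 1 ≤ |Δ| := Int.one_le_abs hΔ
    have h2 : |s * Δ| - |δ| ≤ |s * Δ + δ| := by
      have := abs_sub_abs_le_abs_sub (s * Δ) (-δ)
      rwa [abs_neg, sub_neg_eq_add] at this
    have h3 : |s * Δ| = s * |Δ| := by rw [abs_mul, abs_of_nonneg (by linarith)]
    nlinarith

/-- **Distinct patches are separated coordinatewise**: if `z` lies over `P` and `u` over `P′` then
`⌊s/2⌋ |P′_j − P_j| ≤ |u_j − z_j|` in each coordinate `j` (the patches sit in the period cells `s P + [0, s)³` with offsets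
`≤ ⌊s/2⌋`). [cite: Biggs1974, Def. 19.1] -/
theorem abs_sub_ge_of_over {s : ℕ} (hs : 2 ≤ s) {z u : Site 3} {P P' : ℤ × ℤ × ℤ}
    (hz : (IsPatchBase s z ∧ patchLabel s z = P) ∨
      (IsPatchBase s (z - Pi.single 1 1) ∧ patchLabel s (z - Pi.single 1 1) = P))
    (hu : (IsPatchBase s u ∧ patchLabel s u = P') ∨
      (IsPatchBase s (u - Pi.single 1 1) ∧ patchLabel s (u - Pi.single 1 1) = P')) :
    ((s / 2 : ℕ) : ℤ) * |P'.1 - P.1| ≤ |u 0 - z 0| ∧ ((s / 2 : ℕ) : ℤ) * |P'.2.1 - P.2.1| ≤ |u 1 - z 1| ∧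
      ((s / 2 : ℕ) : ℤ) * |P'.2.2 - P.2.2| ≤ |u 2 - z 2| := by
  obtain ⟨⟨hz0, hz0'⟩, hz1, hz2, hz2'⟩ := offsets_of_over hs hz
  obtain ⟨⟨hu0, hu0'⟩, hu1, hu2, hu2'⟩ := offsets_of_over hs hu
  have hst : 2 * ((s / 2 : ℕ) : ℤ) ≤ (s : ℤ) := by norm_cast; omega
  have ht : (0 : ℤ) ≤ ((s / 2 : ℕ) : ℤ) := by positivity
  have ht1 : (1 : ℤ) ≤ ((s / 2 : ℕ) : ℤ) := by norm_cast; omega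
  have e0 : u 0 - z 0 = (s : ℤ) * (P'.1 - P.1) + ((u 0 - patchCorner s P' 0) - (z 0 - patchCorner s P 0)) := by
    rw [patchCorner_apply_zero, patchCorner_apply_zero]; ring
  have e1 : u 1 - z 1 = (s : ℤ) * (P'.2.1 - P.2.1) + ((u 1 - patchCorner s P' 1) - (z 1 - patchCorner s P 1)) := by
    rw [patchCorner_apply_one, patchCorner_apply_one]; ring
  have e2 : u 2 - z 2 = (s : ℤ) * (P'.2.2 - P.2.2) + ((u 2 - patchCorner s P' 2) - (z 2 - patchCorner s P 2)) := by
    rw [patchCorner_apply_two, patchCorner_apply_two]; ring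
  refine ⟨?_, ?_, ?_⟩
  · rw [e0]; exact mul_abs_le_abs_add hst ht (abs_le.2 ⟨by linarith, by linarith⟩)
  · rw [e1]
    refine mul_abs_le_abs_add hst ht (abs_le.2 ⟨?_, ?_⟩) <;>
      rcases hz1 with h | h <;> rcases hu1 with h' | h' <;> linarith
  · rw [e2]; exact mul_abs_le_abs_add hst ht (abs_le.2 ⟨by linarith, by linarith⟩)

/-- **Distinct patches are far apart in the sup-norm**: if `z` lies over `P`, `u` over `P′`, and
`n + 1 ≤ ⌊s/2⌋ · |P′_j − P_j|` for some coordinate `j`, then `u − z ∉ Λ_n`. [folklore] -/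
theorem sub_not_mem_box_of_over {s : ℕ} (hs : 2 ≤ s) {z u : Site 3} {P P' : ℤ × ℤ × ℤ}
    (hz : (IsPatchBase s z ∧ patchLabel s z = P) ∨
      (IsPatchBase s (z - Pi.single 1 1) ∧ patchLabel s (z - Pi.single 1 1) = P))
    (hu : (IsPatchBase s u ∧ patchLabel s u = P') ∨
      (IsPatchBase s (u - Pi.single 1 1) ∧ patchLabel s (u - Pi.single 1 1) = P'))
    {n : ℕ} (hn : (n : ℤ) + 1 ≤ ((s / 2 : ℕ) : ℤ) * |P'.1 - P.1| ∨ (n : ℤ) + 1 ≤ ((s / 2 : ℕ) : ℤ) * |P'.2.1 - P.2.1| ∨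
      (n : ℤ) + 1 ≤ ((s / 2 : ℕ) : ℤ) * |P'.2.2 - P.2.2|) :
    u - z ∉ box 3 n := by
  obtain ⟨h0, h1, h2⟩ := abs_sub_ge_of_over hs hz hu
  rw [mem_box]
  intro h
  have habs : ∀ j, |u j - z j| ≤ n := fun j => by have := h j; rw [Pi.sub_apply] at this; exact abs_le.2 this
  rcases hn with hn | hn | hn
  · linarith [habs 0]
  · linarith [habs 1]
  · linarith [habs 2]

end CoverSubcritTransfer

end Summit.CriticalPhenomena.PercolationContinuityZ3.Theorems

end
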